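import Mathlib
import Summits.ValiantsHypothesis.ValiantsHypothesis.Theorems.BarrierLeverTransversalMinorLayoutsParabolicGlue

/-!
# Route BarrierLever — conjecture TT (stmt-ValiantsHypothesis-19152): PARABOLIC certificates,
# part 3 — general literal relabelings: (N*) ∧ (P*) ⇒ TT

Seat val-np-p2 gen 3.  CORRECTION to part 2 (`…ParabolicGlue`, p452001): its hypothesis (N)
(nested cardinality tails after CUBE TRANSLATIONS only) is FALSE already at `h = 3`
(`U = {000,001,110,111}`, `W = {000,011,101,110}`: every pair of translates has crossing tails;
seat script `explore.py nexh 3`: 12 failing pairs, all at `r = 4`), so part 2 is correct but idle.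
The right generality lets EACH side be relabeled by an ARBITRARY literal permutation before the
parabolic matrix is applied: with `σ, π : Perm (Fin (h+h))` the degree of a member is the number of
its literals sent into the first half, `#{b : σ (ρ_u b) < h}`; exhaustively at `h = 3` (all pairs,
all `r`) and in samples at `h = 4` some `(σ, π)` gives nested degree tails AND a parabolic
certificate (`explore.py pstar`).  Statements, spelled out as hypotheses below:
* (N*) nested degree tails exist for some literal permutations `σ, π`;
* (P*) nested degree tails for `(σ, π)` ⇒ some parabolic `g` (second-half rows vanish on first-half
  columns) makes the pairing matrix of `σ ∘ ρ_U`, `π ∘ ρ_W` nonsingular;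
and `transversalMinorLayoutsNonsingular_of_nestedRelabelings_of_parabolic : (N*) → (P*) → TT`
(un-relabel both sides with `pairing_good_unrelabel_rows/cols`; `τ_w = ρ_{wᶜ}` entrywise).
(P*) with `σ = π = 1` and equal tails is the graded-Kronecker statement; R1-type vertex splits are
the case where `σ⁻¹` of the first half contains both literals of all but one coordinate.

Definition-free.  WHAT THIS IS NOT: (N*), (P*) are OPEN (censuses only); no proof of TT; nothing on
crux 14610 or VP versus VNP.
-/

-- layout Summits/ValiantsHypothesis/ValiantsHypothesis forces the duplicated namespace component
set_option linter.dupNamespace false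

open Matrix Finset

namespace Summit.ValiantsHypothesis.ValiantsHypothesis.Theorems.BarrierLever.Compression

/-- **(N*) ∧ (P*) ⇒ TT** (general literal relabelings). -/
theorem transversalMinorLayoutsNonsingular_of_nestedRelabelings_of_parabolic
    (Nstar : ∀ (h r : ℕ) (U W : Fin r → Finset (Fin h)), Function.Injective U →
      Function.Injective W → ∃ σ π : Equiv.Perm (Fin (h + h)),
        ∀ t : ℕ, (Finset.univ.filter fun j => t ≤ (Finset.univ.filter fun b : Fin h =>
            (π (if b ∈ W j then Fin.castAdd h b else Fin.natAdd h b)).val < h).card).card ≤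
          (Finset.univ.filter fun i => t ≤ (Finset.univ.filter fun b : Fin h =>
            (σ (if b ∈ U i then Fin.castAdd h b else Fin.natAdd h b)).val < h).card).card)
    (Pstar : ∀ (h r : ℕ) (U W : Fin r → Finset (Fin h)) (σ π : Equiv.Perm (Fin (h + h))),
      Function.Injective U → Function.Injective W →
      (∀ t : ℕ, (Finset.univ.filter fun j => t ≤ (Finset.univ.filter fun b : Fin h =>
            (π (if b ∈ W j then Fin.castAdd h b else Fin.natAdd h b)).val < h).card).card ≤
          (Finset.univ.filter fun i => t ≤ (Finset.univ.filter fun b : Fin h =>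
            (σ (if b ∈ U i then Fin.castAdd h b else Fin.natAdd h b)).val < h).card).card) →
      ∃ g : Matrix (Fin (h + h)) (Fin (h + h)) ℂ,
        (∀ a c : Fin h, g (Fin.natAdd h a) (Fin.castAdd h c) = 0) ∧
        (Matrix.of fun i j : Fin r => (g.submatrix
          (fun b : Fin h => σ (if b ∈ U i then Fin.castAdd h b else Fin.natAdd h b))
          (fun b : Fin h => π (if b ∈ W j then Fin.castAdd h b else Fin.natAdd h b))).det).det
          ≠ 0) :
    Theses.BarrierLever.TransversalMinorLayoutsNonsingular := by
  classical
  intro h r u w hu hw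
  -- the column transversal τ_w is ρ_{wᶜ}
  have hcol : ∀ j, (fun c : Fin h => if c ∈ w j then Fin.natAdd h c else Fin.castAdd h c) =
      (fun c : Fin h => if c ∈ (w j)ᶜ then Fin.castAdd h c else Fin.natAdd h c) := by
    intro j; funext c
    by_cases hc : c ∈ w j
    · rw [if_pos hc, if_neg (by simpa using hc)]
    · rw [if_neg hc, if_pos (Finset.mem_compl.mpr hc)]
  have hwc : Function.Injective (fun j => (w j)ᶜ) := by
    intro j j' hjj'
    exact hw (compl_injective hjj')
  simp only [hcol]
  obtain ⟨σ, π, hnest⟩ := Nstar h r u (fun j => (w j)ᶜ) hu hwc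
  obtain ⟨g, _, hg⟩ := Pstar h r u (fun j => (w j)ᶜ) σ π hu hwc hnest
  refine pairing_good_unrelabel_rows
    (fun (i : Fin r) (b : Fin h) => if b ∈ u i then Fin.castAdd h b else Fin.natAdd h b)
    (fun (j : Fin r) (c : Fin h) => if c ∈ (w j)ᶜ then Fin.castAdd h c else Fin.natAdd h c) σ ?_
  exact pairing_good_unrelabel_cols _ _ π ⟨g, hg⟩

end Summit.ValiantsHypothesis.ValiantsHypothesis.Theorems.BarrierLever.Compression
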